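import Summits.CriticalPhenomena.PercolationContinuityZ3.Theorems.Transplant.SkelPhiCellsSmallMT
import Summits.CriticalPhenomena.PercolationContinuityZ3.Theorems.Transplant.SkelPhiCellsSmallM
import Summits.CriticalPhenomena.PercolationContinuityZ3.Theorems.Transplant.SkelPhiFaceRegionNT
import Summits.CriticalPhenomena.PercolationContinuityZ3.Theorems.Transplant.SkelPhiFaceRegionN
import Summits.CriticalPhenomena.PercolationContinuityZ3.Theorems.Transplant.SkelPhiFaceRegionNb
import Literature.Probability.Percolation.OrientedHistorySiteRenormalizationRun
import HarnessLib
/-!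
(R-40) SUCCESSOR `…T` (hp-8 g42, 2026-08-23; ruling p3-g16 06:23:56Z, J18): the twin of `SkelPhiFaceRegionNbS` over the PER-AXIS creep cap `PCells2T` (PlanarCells2TDefs:
`c i ≤ r (oth i)` instead of the uniform `c i ≤ cmax ≤ r j`); statements and proofs VERBATIM with `PCells2S ↦ PCells2T` (+ the renames of record of the T layer below it);
the only mathematical touch points are the places that read the cap, which only ever need the cross form `c (oth j) ≤ r j` (listed in the lane line of this file's landing).
NO landed file is edited; `SkelPhiFaceRegionNbS` stays valid (and is an instance of this file through `PCells2S.toT`). NON-VACUITY: inherited verbatim from `SkelPhiFaceRegionNbS` (same witness line).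

# N2 (frames-only node `SamePDropOfSkeletonFrm₁`, OPEN) — WAVE 1, (F) face-data column over STAGGERED cells ((R-22) `PCells2T`, (R-28)(β) one landing per file): the twin of N1's `SkelPhiFaceRegionNb`

builds on p205010 (kernel theorem, internal audit signed; external expert review pending) — nothing in this file uses p205010; NOTHING is claimed about the
open node `SamePDropOfSkeletonFrm₁` (`SamePDropOfSkeletonNeg₁` is CLOSED in the tree and untouched by this file).
Status sentence (coordinator 2026-08-20T04:30Z): "θ(p_c) = 0 on ℤ^d, all d ≥ 2 — kernel-verified (Lean 4/Mathlib, standard axioms); internal adversarial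
audit SIGNED 2026-08-20 04:29Z; external expert review pending."
Lane `prim-bschramm`, seat `prim-hp-8` (gen 40); helper file (`--supports stmt-CriticalPhenomena-4575 --as helper`); design owner p3-g15 ((R-22) staggered
cells `PCells2T`, (R-27)/(R-29) far regions of record `FarNS/FarNS₂`, (R-28)(β), naming 2026-08-22T23:00:04Z: suffix `S`).
PORT RULES (HOME/prim-hp-8/code/gen40/orient/bin/port_s.py = stmt-g19's port_orient.py + the G token table): the cells are `P : PCells2T`, every box is
read about the STAGGERED centre `cenS` (`PlanarCells2SDefs/SFar/ContainS/SArm/SepS/SepInfS/LevelsS/EfarN2S`), the scheme record is `cellGeomSG₂T`/`cellGeomSG₂bT`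
(`SkelPhiCellsWeakGS/…SmallMS`: narrow arm `BtwNS`, two-block far region `FarNS₂`), the history-site API is the ORIENTED one at `qNE` where it occurs
(`ochoice qNE`, `onwardO`, `Valid₂O`, `IsRun₂O`, …, (R-18)); EVERY declaration is re-declared with the suffix `S` (same namespace). Docstrings/citations are N1's.
N1 HEADER (kept for the reader):
* `Win_farAS₂_subset_Efar_b`, `M_subset_Win_farAS₂_b (hb)`, `sep_Q_Win_farAS₂_b`, `disjoint_Win_farAS₂_Stub_b`, `disjoint_Win_farAS₂_Ewv_b`.
[cite: KozmaNitzan2024, §4 p. 26 (E_{v,x}, M_x), p. 27 ((30)), p. 30 (Step III), p. 31 (D is a subbox of Ω), Lemma 11 (p. 22)]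
-/
noncomputable section

open scoped Classical

namespace Summit.CriticalPhenomena.PercolationContinuityZ3.Theorems.Transplant

namespace Skelφ

open Literature.Probability.Percolation Literature.Probability.LatticeModels SimpleGraph KNCells Contour
open Literature.Probability.Percolation.KozmaNitzan
open Literature.Probability.Percolation.KozmaNitzan.Cells (oth oth_ne sgOf sgOf_sign stepVec_apply_fst stepVec_apply_oth eq_oth_of_ne oth_oth)
open Literature.Barriers.CriticalPhenomena (graphBall graphBall_finite mem_graphBall_self graphBall_mono)
open BoxProdZ2 (ConcRadiiG)

variable {V : Type} [DecidableEq V] {G : SimpleGraph V} [G.LocallyFinite] {ψ : V → Site 2}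

variable (P : PCells2T) (w₀ : V) {Λ : ConcRadiiG} (b₀ : Fin 2 → ℕ)

/-- **The face-step window lies in the far region of the twin scheme** (`1 ≤ rE`). [cite: KozmaNitzan2024, §4 p. 31 (D ⊆ Ω)] -/
theorem Win_farAS₂_subset_Efar_bT (hlip : Lip G ψ) (hws : WeakSteps G ψ) {a' : ℕ} {x : Site 2} {du : MDir} (hE : 1 ≤ Λ.rE a' x du) (j : ℕ) :
    Win G ψ w₀ (P.farASS₂ x du j) (Λ.rE a' x du) ⊆ (cellGeomSG₂bT G ψ P w₀ Λ b₀).Efar a' x du := by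
  simp only [cellGeomSG₂bT_Efar]; exact Win_farAS₂_subset_EfarT P w₀ hlip hws hE j

/-- **The small target lies in the face-step window**: `M_{a'}(x + du) ⊆ Win w₀ (farASS₂ x du j) (rE_{a'}(x,du))` (`j ≤ K`, `rM ≤ rE`, `b₀ ≤ 3r`).
[cite: KozmaNitzan2024, §4 p. 26 (M_x ⊆ E_{v,x}), Lemma 11 (p. 22)] -/
theorem M_subset_Win_farAS₂_bT (hW : WF2 P.toPCells2 Λ) (hb : ∀ i, b₀ i ≤ 3 * P.r i) {a' : ℕ} (x : Site 2) (du : MDir) {j : ℕ} (hj : j ≤ P.K) :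
    (cellGeomSG₂bT G ψ P w₀ Λ b₀).M a' (x + stepVec du) ⊆ Win G ψ w₀ (P.farASS₂ x du j) (Λ.rE a' x du) :=
  (M_bT_subset_M P w₀ Λ hb a' _).trans (M_subset_Win_farAS₂T P w₀ hW x du hj)

omit [DecidableEq V] in
/-- **No `G`-edge from the cube span `Q_a(x)` into the face-step window** (twin scheme). [cite: KozmaNitzan2024, §4 p. 26 ((29))] -/
theorem sep_Q_Win_farAS₂_bT [DecidableEq V] (hlip : Lip G ψ) (a : ℕ) (x : Site 2) (du : MDir) (j R : ℕ) :
    KNCells.Sep G ((cellGeomSG₂bT G ψ P w₀ Λ b₀).Q a x) (Win G ψ w₀ (P.farASS₂ x du j) R) := by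
  simp only [cellGeomSG₂bT_Q]; exact sep_Q_Win_farAS₂T P w₀ hlip a x du j R

/-- The face-step window misses the stub span (twin scheme). [folklore] -/
theorem disjoint_Win_farAS₂_Stub_bT (a' : ℕ) (x : Site 2) (du : MDir) {j : ℕ} (hjK : j + 1 ≤ P.K) (R : ℕ) :
    Disjoint (Win G ψ w₀ (P.farASS₂ x du j) R) ((cellGeomSG₂bT G ψ P w₀ Λ b₀).Stub a' x du j) := by
  simp only [cellGeomSG₂bT_Stub]; exact disjoint_Win_farAS₂_StubT P w₀ a' x du hjK R

/-- The face-step window misses `E_{w,v}` of the incoming edge (twin scheme, `du ≠ rev δw`). [folklore] -/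
theorem disjoint_Win_farAS₂_Ewv_bT (a : ℕ) (w : Site 2) {δw du : MDir} (hne : du ≠ rev δw) (j R : ℕ) :
    Disjoint (Win G ψ w₀ (P.farASS₂ (w + stepVec δw) du j) R) ((cellGeomSG₂bT G ψ P w₀ Λ b₀).Ewv a w δw) := by
  simp only [cellGeomSG₂bT_Ewv]; exact disjoint_Win_farAS₂_EwvT P w₀ a w hne j R

end Skelφ

end Summit.CriticalPhenomena.PercolationContinuityZ3.Theorems.Transplant

end
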